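import Mathlib.Tactic.Group
import Literature.AnabelianGeometry.SemiGraphs.ArithBTempCentraliserFree
import HarnessLib

/-!
# [SemiAnbd] Thm 5.4: the DESIGN binder `hBR` (branch transport of the outer model) PRODUCED from a
# chart-level representation of the arithmetic action by automorphisms of the semi-graph of anabelioids

Mochizuki, *Semi-graphs of anabelioids*, Publ. RIMS **42** (2006), §5 Def 5.1 (i) p. 62 ("`ρ_𝔾 : π̂₁(A) → Aut(𝔾)`,
where `Aut(𝔾)` denotes the group of automorphisms of `𝔾` as a … semi-graph of anabelioids"), Prop 3.6 (iv) p. 39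
(pull-back along a morphism ≅ `B^temp` of the induced homomorphism), §2 Rmk 2.4.2 p. 26 (compatibility with the
branch maps up to conjugation), Thm 5.4 p. 66 [cite: MochizukiSemiAnbd2006, Def 5.1 (i), p. 62].

abc-iut cell, L3 T54 board (abc-iut-L3-lead gen 6, β31 (2): "hBR (DESIGN) is the only T54 binder left without a
producer"); seat abc-iut-w4-d071 (gen 5).  PROOF-ONLY: no definition, no new named fact.

WHAT IS PROVED (`hBR_of_chartRepresentation`).  The T54 capstones / integrated line carry the DESIGN binder
`hBR` — for every `a ∈ Π_A`, branch `b` abutting to `v` and verticial `φ : Π_v → π₁^temp(𝒢)`: SOME representative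
`Φ` of `ρ(a)` carries `φ(Π_v)` and `φ(Π_b)` SIMULTANEOUSLY, by ONE conjugation `x′`, onto `φ′(Π_{a·v})` and
`φ′(Π_{a·b})` for a verticial `φ′` at `a·v`.  In print this is no hypothesis: `ρ(a)` IS (the outer class of
`B^temp` of) an AUTOMORPHISM `F_a` of the semi-graph of anabelioids covering the action on the underlying
semi-graph.  Here `hBR` is DERIVED from exactly that: a family `F a : Hom 𝒢 𝒢` with 2-cells `θ a`, whose
chart-level representative represents `ρ a` (the (D1a) datum `hrep` of the integrated line, abc-iut-w5-d141's
currency), whose base IS `baseAct a` (`hbase`), and whose vertex / edge homomorphisms are SURJECTIVE (an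
automorphism is locally trivial, Def 2.2 (ii)).  Ingredients: abc-iut-L3-t10's `Hom.conj_of_chartPullbackWith_iso`
(`φ̂ ∘ φ = conj g ∘ ψ ∘ F_v`), the 2-cell law `ConjugatorFamily.spec` (`F_v ∘ b_* = conj θ_b ∘ (F b)_* ∘ F_e`), Thm 3.7
(i) existence of verticial homomorphisms (`verticialInjective_holds`).  The auxiliary
`hBR_of_chartRepresentation_aux` is the same statement with the target vertex/branch generalised (no transport
along `hbase` inside the proof).  Nothing here bears on [IUTchIII] Cor. 3.12; typed ≠ proved elsewhere.
-/

namespace Literature.AnabelianGeometry.SemiGraphs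

namespace ProfiniteSemiGraph

open CategoryTheory Topology
open Literature.AnabelianGeometry.EtaleTheta

universe u w

variable {𝒢 : ProfiniteSemiGraph.{u}} (c : TemperedPiChart 𝒢) {PA : Type w} [Group PA]
  (ρ' : PA →* TopOut c.G) (baseAct : PA →* Aut 𝒢.graph)

/-- Range of a branch homomorphism re-indexed at an edge: the branch subgroup.
[cite: MochizukiSemiAnbd2006, §2 p.23] -/
theorem range_brHomAt_eq_branchSubgroup (b : 𝒢.graph.Branch) (v : 𝒢.graph.Vertex)
    (h : 𝒢.graph.abuts b = some v) {f : 𝒢.graph.Edge} (q : 𝒢.graph.edgeOf b = f) :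
    (𝒢.brHomAt b v h f q).toMonoidHom.range = 𝒢.branchSubgroup b v h := by
  subst q; rfl

/-- **Branch transport from a chart-level representation — target vertex and branch generalised.**
[cite: MochizukiSemiAnbd2006, Def 5.1 (i), p. 62] -/
theorem hBR_of_chartRepresentation_aux (h37 : 𝒢.Thm37Hypotheses) (F : Hom 𝒢 𝒢) (θ : F.ConjugatorFamily)
    (Φ : contMulAut c.G) (φhat : c.G →ₜ* c.G) (hΦ : ∀ t, (Φ : MulAut c.G) t = φhat t)
    (hiso : Nonempty (F.chartPullbackWith θ c c ≅ BTemp.res φhat))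
    (hsurjV : ∀ v, Function.Surjective (F.hV v)) (hsurjE : ∀ e, Function.Surjective (F.hE e))
    (b : 𝒢.graph.Branch) (v : 𝒢.graph.Vertex) (hb : 𝒢.graph.abuts b = some v)
    (φ : 𝒢.Gv v →ₜ* c.G) (hφ : IsVerticialHom c v φ)
    (w : 𝒢.graph.Vertex) (hw : F.base.vertexMap v = w) (b₂ : 𝒢.graph.Branch) (hb₂ : F.base.branchMap b = b₂)
    (hb₂w : 𝒢.graph.abuts b₂ = some w) :
    ∃ φ' : 𝒢.Gv w →ₜ* c.G, IsVerticialHom c w φ' ∧ ∃ x' : c.G,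
      Subgroup.map (Φ : MulAut c.G).toMonoidHom φ.toMonoidHom.range =
        Subgroup.map (MulAut.conj x').toMonoidHom φ'.toMonoidHom.range ∧
      Subgroup.map (Φ : MulAut c.G).toMonoidHom (Subgroup.map φ.toMonoidHom (𝒢.branchSubgroup b v hb)) =
        Subgroup.map (MulAut.conj x').toMonoidHom
          (Subgroup.map φ'.toMonoidHom (𝒢.branchSubgroup b₂ w hb₂w)) := by
  subst hw; subst hb₂
  -- a verticial homomorphism at `F v` and the conjugator of the chart-level representative
  obtain ⟨_, ψ, hψ, -⟩ := (verticialInjective_holds 𝒢 h37 c (F.base.vertexMap v)).1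
  obtain ⟨g, hg⟩ := F.conj_of_chartPullbackWith_iso θ c c φhat hiso v φ ψ hφ hψ
  -- the 2-cell at `b`
  set γ : 𝒢.Gv (F.base.vertexMap v) := θ.θ b v hb with hγ
  refine ⟨ψ, hψ, g * ψ γ, ?_, ?_⟩
  · -- vertex clause
    apply le_antisymm
    · rintro _ ⟨_, ⟨t, rfl⟩, rfl⟩
      refine ⟨ψ (γ⁻¹ * F.hV v t * γ), ⟨_, rfl⟩, ?_⟩
      change (g * ψ γ) * ψ (γ⁻¹ * F.hV v t * γ) * (g * ψ γ)⁻¹ = (Φ : MulAut c.G) (φ t)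
      rw [hΦ, hg, map_mul, map_mul, map_inv]
      group
    · rintro _ ⟨_, ⟨u, rfl⟩, rfl⟩
      obtain ⟨t, ht⟩ := hsurjV v (γ * u * γ⁻¹)
      refine ⟨φ t, ⟨t, rfl⟩, ?_⟩
      change (Φ : MulAut c.G) (φ t) = (g * ψ γ) * ψ u * (g * ψ γ)⁻¹
      rw [hΦ, hg, ht, map_mul, map_mul, map_inv]
      group
  · -- branch clause: the 2-cell `θ_b` and surjectivity of `F_e`
    have hspec : ∀ x : 𝒢.Ge (𝒢.graph.edgeOf b),
        F.hV v (𝒢.brHom b v hb x) = γ * F.brComp b v hb x * γ⁻¹ := fun x => (θ.spec b v hb x).symm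
    have hbr : ∀ x, F.brComp b v hb x =
        𝒢.brHomAt (F.base.branchMap b) (F.base.vertexMap v) hb₂w
          (F.base.edgeMap (𝒢.graph.edgeOf b)) (F.base.edgeOf_branchMap b) (F.hE (𝒢.graph.edgeOf b) x) :=
      fun x => rfl
    apply le_antisymm
    · rintro _ ⟨_, ⟨_, ⟨x, rfl⟩, rfl⟩, rfl⟩
      refine ⟨_, ⟨𝒢.brHomAt (F.base.branchMap b) (F.base.vertexMap v) hb₂w
          (F.base.edgeMap (𝒢.graph.edgeOf b)) (F.base.edgeOf_branchMap b) (F.hE (𝒢.graph.edgeOf b) x),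
        (by rw [← 𝒢.range_brHomAt_eq_branchSubgroup _ _ hb₂w (F.base.edgeOf_branchMap b)]; exact ⟨_, rfl⟩),
        rfl⟩, ?_⟩
      change (g * ψ γ) * ψ (𝒢.brHomAt (F.base.branchMap b) (F.base.vertexMap v) hb₂w
          (F.base.edgeMap (𝒢.graph.edgeOf b)) (F.base.edgeOf_branchMap b) (F.hE (𝒢.graph.edgeOf b) x)) *
          (g * ψ γ)⁻¹ = (Φ : MulAut c.G) (φ (𝒢.brHom b v hb x))
      rw [hΦ, hg, hspec, hbr, map_mul, map_mul, map_inv]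
      group
    · rintro _ ⟨_, ⟨y₁, hy₁, rfl⟩, rfl⟩
      rw [← 𝒢.range_brHomAt_eq_branchSubgroup _ _ hb₂w (F.base.edgeOf_branchMap b)] at hy₁
      obtain ⟨y₂, rfl⟩ := hy₁
      obtain ⟨x, hx⟩ := hsurjE (𝒢.graph.edgeOf b) y₂
      refine ⟨φ (𝒢.brHom b v hb x), ⟨𝒢.brHom b v hb x, ⟨x, rfl⟩, rfl⟩, ?_⟩
      change (Φ : MulAut c.G) (φ (𝒢.brHom b v hb x)) =
        (g * ψ γ) * ψ (𝒢.brHomAt (F.base.branchMap b) (F.base.vertexMap v) hb₂w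
          (F.base.edgeMap (𝒢.graph.edgeOf b)) (F.base.edgeOf_branchMap b) y₂) * (g * ψ γ)⁻¹
      rw [hΦ, hg, hspec, hbr, hx, map_mul, map_mul, map_inv]
      group

/-- **`hBR` PRODUCED from a chart-level representation of the arithmetic action by automorphisms of the
semi-graph of anabelioids** (Def 5.1 (i): `ρ_𝔾 : π̂₁(A) → Aut(𝔾)`).  If every `ρ(a)` is represented by the
chart-level representative `φ̂_a` of an endomorphism `F a : 𝒢 → 𝒢` of the semi-graph of anabelioids (2-cells
`θ a`, `(F a)^*_θ ≅ B^temp(φ̂_a)` — the (D1a) datum `hrep` of the integrated Thm 5.4 line) whose underlying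
semi-graph map IS `baseAct a` and whose vertex and edge homomorphisms are surjective (automorphisms), then the
T54 DESIGN binder `hBR` HOLDS: for every branch `b` abutting to `v` and verticial `φ` at `v`, some
representative `Φ` of `ρ(a)` carries `φ(Π_v)` and `φ(Π_b)` by one conjugation `x′` onto `φ′(Π_{a·v})`,
`φ′(Π_{a·b})` for a verticial `φ′` at `a·v`. [cite: MochizukiSemiAnbd2006, Def 5.1 (i), p. 62] -/
theorem hBR_of_chartRepresentation (h37 : 𝒢.Thm37Hypotheses) (F : PA → Hom 𝒢 𝒢)
    (θ : ∀ a, (F a).ConjugatorFamily)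
    (hrep : ∀ a, ∃ (Φ : contMulAut c.G) (φhat : c.G →ₜ* c.G), TopOut.mk c.G Φ = ρ' a ∧
      (∀ t, (Φ : MulAut c.G) t = φhat t) ∧ Nonempty ((F a).chartPullbackWith (θ a) c c ≅ BTemp.res φhat))
    (hbase : ∀ a, (F a).base = (baseAct a).hom)
    (hsurjV : ∀ a v, Function.Surjective ((F a).hV v))
    (hsurjE : ∀ a e, Function.Surjective ((F a).hE e)) :
    ∀ (a : PA) (b : 𝒢.graph.Branch) (v : 𝒢.graph.Vertex) (hb : 𝒢.graph.abuts b = some v)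
      (φ : 𝒢.Gv v →ₜ* c.G), IsVerticialHom c v φ →
      ∃ Φ : contMulAut c.G, TopOut.mk _ Φ = ρ' a ∧
        ∃ φ' : 𝒢.Gv ((baseAct a).hom.vertexMap v) →ₜ* c.G,
          IsVerticialHom c ((baseAct a).hom.vertexMap v) φ' ∧
          ∃ x' : c.G,
            Subgroup.map (Φ : MulAut c.G).toMonoidHom φ.toMonoidHom.range =
              Subgroup.map (MulAut.conj x').toMonoidHom φ'.toMonoidHom.range ∧
            Subgroup.map (Φ : MulAut c.G).toMonoidHom
                (Subgroup.map φ.toMonoidHom (𝒢.branchSubgroup b v hb)) =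
              Subgroup.map (MulAut.conj x').toMonoidHom
                (Subgroup.map φ'.toMonoidHom
                  (𝒢.branchSubgroup ((baseAct a).hom.branchMap b) ((baseAct a).hom.vertexMap v)
                    ((baseAct a).hom.abuts_branchMap b v hb))) := by
  intro a b v hb φ hφ
  obtain ⟨Φ, φhat, hmk, hΦ, hiso⟩ := hrep a
  obtain ⟨φ', hφ', x', h1, h2⟩ := hBR_of_chartRepresentation_aux c h37 (F a) (θ a) Φ φhat hΦ hiso (hsurjV a)
    (hsurjE a) b v hb φ hφ ((baseAct a).hom.vertexMap v) (by rw [hbase]) ((baseAct a).hom.branchMap b)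
    (by rw [hbase]) ((baseAct a).hom.abuts_branchMap b v hb)
  exact ⟨Φ, hmk, φ', hφ', x', h1, h2⟩

end ProfiniteSemiGraph

end Literature.AnabelianGeometry.SemiGraphs
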